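import Summits.Parity.GeneralizedHardyLittlewood.Theorems.ChenParityOracleBLAPParityOracleChenTools
import Literature.NumberTheory.LFunctions.TaoLogChowlaMoebiusOfLiouville
import HarnessLib

/-!
# Route `ParityWeightedChenSwitching` — crux `ParityChenInequality` (stmt-Parity-18666): μ-parity bookkeeping

Support file for S1 = `ParityChenInequality` (Chen's twin-form inequality chain run with the PARITY
WEIGHT `u(n) = (1 − μ(n))/2` on both of Chen's sieved sequences, at the fixed level `0.499`).
This file is the Möbius analogue of the sibling route's bookkeeping file
`ChenParityOracleBLAPParityOracleChenTools` (which treats the Liouville oracle `½(1 − λ)`): the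
twisted sifted sum of an indicator sequence `1_S` against `e = 1_S · f` (any `f`, here `f = μ`) is the
`u`-weighted rough sum over `S`; the twisted congruence sums are `∑_{n ∈ S, d ∣ n} f(n)`; the inner sums
of the crux's error term `E₁` (over `p ≤ x` prime with `m ∣ p + 2`) coincide with the Möbius congruence
sums of the tree's twin sequence `𝒜(x) = {p + 2 : 2 < p ≤ x}` (the prime `p = 2` contributes
`μ(4) = 0`). The sieve input downstream is the twisted Rosser sieve
`Literature.NumberTheory.Sieve.Iwaniec1980_twisted_{upper,lower}_of_half_lt` (`RosserSieveTwisted.lean`).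

References: Chen Jing-run, Sci. Sinica 16 (1973) [ChenSciSinica1973]; M. B. Nathanson, *Additive
Number Theory: The Classical Bases* (1996), Ch. 10 [Nathanson1996]; H. Iwaniec, Acta Arith. 36 (1980)
[IwaniecActaArith1980]; G. Harman, *Prime-Detecting Sieves* (2007), §14.2 [Harman2007].
-/

namespace Summit.Parity.GeneralizedHardyLittlewood.Theorems

open Finset Filter Topology
open scoped ArithmeticFunction.Moebius ArithmeticFunction.Omega
open Literature.NumberTheory.Sieve Literature.NumberTheory.Sieve.Chen
  Literature.NumberTheory.Sieve.ChenSieve Literature.NumberTheory.Sieve.SieveSequence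

/-! ### The parity weight `u(n) = (1 − μ(n))/2` -/

/-- `0 ≤ (1 − μ(n))/2`. -/
theorem moebiusParityWeight_nonneg (n : ℕ) : 0 ≤ (1 - (μ n : ℝ)) / 2 := by
  have h := Literature.NumberTheory.LFunctions.abs_moebius_real_le_one n
  rw [abs_le] at h
  linarith [h.2]

/-- `(1 − μ(n))/2 ≤ 1`. -/
theorem moebiusParityWeight_le_one (n : ℕ) : (1 - (μ n : ℝ)) / 2 ≤ 1 := by
  have h := Literature.NumberTheory.LFunctions.abs_moebius_real_le_one n
  rw [abs_le] at h
  linarith [h.1]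

/-- On a prime the parity weight is `1`: `(1 − μ(p))/2 = 1`. -/
theorem moebiusParityWeight_prime {p : ℕ} (hp : p.Prime) : (1 - (μ p : ℝ)) / 2 = 1 := by
  rw [ArithmeticFunction.moebius_apply_prime hp]
  push_cast
  norm_num

/-- For a nonnegative weight `a(n)` and `e(n) = a(n) f(n)` with `|f| ≤ 1`: `e(n) ≤ a(n)`. -/
theorem mul_le_self_of_abs_le_one {a f : ℝ} (ha : 0 ≤ a) (hf : |f| ≤ 1) : a * f ≤ a := by
  have : a * f ≤ a * 1 := mul_le_mul_of_nonneg_left (le_of_abs_le hf) ha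
  linarith

/-! ### Twisted sums of an indicator sequence against `e = 1_S · f` -/

/-- **The twisted sifted sum of an indicator sequence is the weighted rough sum.** For a finite set
`S` of positive integers `≤ M`, the weights `a = 1_S`, `e = 1_S · f` and a real sifting parameter `w`:
`∑_{n ≤ M, (n, P(w)) = 1} ½(a(n) − e(n)) = ∑_{n ∈ S, n has no prime factor < w} (1 − f(n))/2`. -/
theorem twistedSifted_indicator_eq_sum (S : Finset ℕ) {M : ℕ} (hS : S ⊆ Finset.Ioc 0 M) (w : ℝ)
    (f : ℕ → ℝ) :
    ∑ n ∈ (Finset.Ioc 0 ⌊((M : ℕ) : ℝ)⌋₊).filter (fun n : ℕ => n.Coprime (primesProdBelow w)),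
        ((if n ∈ S then (1 : ℝ) else 0) - (if n ∈ S then (1 : ℝ) else 0) * f n) / 2 =
      ∑ n ∈ S.filter (fun n => IsRough ⌈w⌉₊ n), (1 - f n) / 2 := by
  classical
  rw [Nat.floor_natCast]
  have hS0 : ∀ n ∈ S, n ≠ 0 := fun n hn => by
    have := (Finset.mem_Ioc.mp (hS hn)).1; omega
  have hsummand : ∀ n ∈ (Finset.Ioc 0 M).filter (fun n : ℕ => n.Coprime (primesProdBelow w)),
      ((if n ∈ S then (1 : ℝ) else 0) - (if n ∈ S then (1 : ℝ) else 0) * f n) / 2 =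
        if n ∈ S then (1 - f n) / 2 else 0 := by
    intro n _
    by_cases hn : n ∈ S
    · rw [if_pos hn, if_pos hn, one_mul]
    · rw [if_neg hn, if_neg hn]; ring
  rw [Finset.sum_congr rfl hsummand, ← Finset.sum_filter, Finset.filter_filter]
  congr 1
  ext n
  simp only [Finset.mem_filter, Finset.mem_Ioc]
  constructor
  · rintro ⟨-, hcop, hn⟩
    exact ⟨hn, (Chen.coprime_primesProdBelow_iff_isRough (hS0 n hn)).mp hcop⟩
  · rintro ⟨hn, hr⟩
    have h := Finset.mem_Ioc.mp (hS hn)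
    exact ⟨⟨h.1, h.2⟩, (Chen.coprime_primesProdBelow_iff_isRough (hS0 n hn)).mpr hr, hn⟩

/-- **The twisted congruence sums of an indicator sequence.** For `S ⊆ (0, M]` and `e = 1_S · f`:
`∑_{n ≤ M, d ∣ n} e(n) = ∑_{n ∈ S, d ∣ n} f(n)`. -/
theorem twistedCongrSum_indicator_eq_sum (S : Finset ℕ) {M : ℕ} (hS : S ⊆ Finset.Ioc 0 M) (d : ℕ)
    (f : ℕ → ℝ) :
    ∑ n ∈ (Finset.Ioc 0 ⌊((M : ℕ) : ℝ)⌋₊).filter (d ∣ ·), (if n ∈ S then (1 : ℝ) else 0) * f n =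
      ∑ n ∈ S.filter (fun n => d ∣ n), f n := by
  classical
  rw [Nat.floor_natCast]
  have h1 : ∑ n ∈ (Finset.Ioc 0 M).filter (d ∣ ·), (if n ∈ S then (1 : ℝ) else 0) * f n =
      ∑ n ∈ (Finset.Ioc 0 M).filter (d ∣ ·), (if n ∈ S then f n else 0) :=
    Finset.sum_congr rfl fun n _ => by split_ifs <;> simp
  rw [h1, ← Finset.sum_filter, Finset.filter_filter]
  congr 1
  ext n
  simp only [Finset.mem_filter]
  constructor
  · rintro ⟨-, hd, hn⟩; exact ⟨hn, hd⟩
  · rintro ⟨hn, hd⟩; exact ⟨hS hn, hd, hn⟩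

/-! ### The twin sequence `𝒜(x)` twisted by `μ` -/

/-- The Möbius twist of the twin weights is dominated by them: `1_𝒜(n) μ(n) ≤ 1_𝒜(n)`. -/
theorem twinWeight_mul_moebius_le (x n : ℕ) :
    twinWeight x n * (μ n : ℝ) ≤ (twinSeq x).a n :=
  mul_le_self_of_abs_le_one (twinWeight_nonneg x n) (Literature.NumberTheory.LFunctions.abs_moebius_real_le_one n)

/-- The weights of `𝒜(x)` are an indicator. -/
theorem twinWeight_eq_indicator (x n : ℕ) :
    twinWeight x n = if n ∈ twinSieveSet x then (1 : ℝ) else 0 := rfl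

/-- The twisted sifted sum of `𝒜(x)` against `e = 1_𝒜 μ` at height `x + 2` is the `u`-weighted count
`Φ₁ = ∑_{n ∈ 𝒜(x), n has no prime factor < w} (1 − μ(n))/2`. -/
theorem twistedSifted_twinSeq_moebius_eq (x : ℕ) (w : ℝ) :
    ∑ n ∈ (Finset.Ioc 0 ⌊((x + 2 : ℕ) : ℝ)⌋₊).filter (fun n : ℕ => n.Coprime (primesProdBelow w)),
        ((twinSeq x).a n - twinWeight x n * (μ n : ℝ)) / 2 =
      ∑ n ∈ (twinSieveSet x).filter (fun n => IsRough ⌈w⌉₊ n), (1 - (μ n : ℝ)) / 2 := by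
  have h := twistedSifted_indicator_eq_sum (twinSieveSet x) (twinSieveSet_subset_Ioc x) w
    (fun n => (μ n : ℝ))
  refine Eq.trans (Finset.sum_congr rfl fun n _ => ?_) h
  rfl

/-- The twisted congruence sums of `𝒜(x)` against `e = 1_𝒜 μ`: `E_d(x + 2) = ∑_{n ∈ 𝒜(x), d ∣ n} μ(n)`. -/
theorem twistedCongrSum_twinSeq_moebius_eq (x d : ℕ) :
    ∑ n ∈ (Finset.Ioc 0 ⌊((x + 2 : ℕ) : ℝ)⌋₊).filter (d ∣ ·), twinWeight x n * (μ n : ℝ) =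
      ∑ n ∈ (twinSieveSet x).filter (fun n => d ∣ n), (μ n : ℝ) := by
  have h := twistedCongrSum_indicator_eq_sum (twinSieveSet x) (twinSieveSet_subset_Ioc x) d
    (fun n => (μ n : ℝ))
  refine Eq.trans (Finset.sum_congr rfl fun n _ => ?_) h
  rfl

/-- `μ(4) = 0`. -/
theorem moebius_four : μ 4 = 0 := by
  rw [ArithmeticFunction.moebius_eq_zero_of_not_squarefree]
  intro h
  have := h 2 ⟨1, by norm_num⟩
  norm_num at this

/-- **The inner sums of the crux's error term `E₁` are the Möbius congruence sums of `𝒜(x)`**: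
`∑_{n ∈ 𝒜(x), m ∣ n} μ(n) = ∑_{p ≤ x prime, m ∣ p + 2} μ(p + 2)` (the two index sets differ by the prime
`p = 2` only, whose term is `μ(4) = 0`). -/
theorem sum_moebius_twinSieveSet_filter_dvd_eq (x m : ℕ) :
    ∑ n ∈ (twinSieveSet x).filter (fun n => m ∣ n), (μ n : ℝ) =
      ∑ p ∈ (Nat.primesLE x).filter (fun p => m ∣ p + 2), (ArithmeticFunction.moebius (p + 2) : ℝ) := by
  classical
  -- the left side as a sum over the primes `2 < p ≤ x` with `m ∣ p + 2`
  have hL : ∑ n ∈ (twinSieveSet x).filter (fun n => m ∣ n), (μ n : ℝ) =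
      ∑ p ∈ ((Finset.Ioc 2 x).filter Nat.Prime).filter (fun p => m ∣ p + 2), (μ (p + 2) : ℝ) := by
    rw [twinSieveSet, Finset.filter_map, Finset.sum_map]
    rfl
  rw [hL]
  symm
  refine (Finset.sum_subset (fun p hp => ?_) (fun p hp hnp => ?_)).symm
  · simp only [Finset.mem_filter, Finset.mem_Ioc, Nat.mem_primesLE] at hp ⊢
    exact ⟨⟨hp.1.1.2, hp.1.2⟩, hp.2⟩
  · simp only [Finset.mem_filter, Finset.mem_Ioc, Nat.mem_primesLE, not_and] at hp hnp
    have hp2 : p = 2 := by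
      by_contra h
      have h2 : 2 < p := lt_of_le_of_ne hp.1.2.two_le (Ne.symm h)
      exact hnp ⟨⟨h2, hp.1.1⟩, hp.1.2⟩ hp.2
    subst hp2
    simp [moebius_four]

/-- The oracle remainder sum of the crux: for `0 ≤ Y`,
`∑_{d < Y, d ∣ P(w)} |∑_{n ≤ x+2, d ∣ n} 1_𝒜(n) μ(n)| ≤ ∑_{1 ≤ m ≤ ⌊Y⌋} |∑_{p ≤ x, m ∣ p+2} μ(p+2)|`. -/
theorem twistedRemainderSum_twinSeq_moebius_le (x : ℕ) (w Y : ℝ) :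
    ∑ d ∈ (Finset.range ⌈Y⌉₊).filter (· ∣ primesProdBelow w),
        |∑ n ∈ (Finset.Ioc 0 ⌊((x + 2 : ℕ) : ℝ)⌋₊).filter (d ∣ ·), twinWeight x n * (μ n : ℝ)| ≤
      ∑ m ∈ Finset.Icc 1 ⌊Y⌋₊,
        |∑ p ∈ (Nat.primesLE x).filter (fun p => m ∣ p + 2), (ArithmeticFunction.moebius (p + 2) : ℝ)| := by
  refine le_trans (Finset.sum_le_sum fun d _ => ?_)
    (sum_range_filter_dvd_le_sum_Icc (fun d => abs_nonneg _) w)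
  rw [twistedCongrSum_twinSeq_moebius_eq, sum_moebius_twinSieveSet_filter_dvd_eq]

/-! ### The sequences `𝒜_q` twisted by `μ` (used by (B)ᵘ) -/

/-- The twisted sifted sum of `𝒜_q` against `e = 1_{𝒜_q} μ` at height `x + 2`:
`∑_{n ∈ 𝒜(x), q ∣ n, n has no prime factor < w} (1 − μ(n))/2`. -/
theorem twistedSifted_twinSeqMult_moebius_eq (x q : ℕ) (w : ℝ) :
    ∑ n ∈ (Finset.Ioc 0 ⌊((x + 2 : ℕ) : ℝ)⌋₊).filter (fun n : ℕ => n.Coprime (primesProdBelow w)),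
        (twinWeightMult x q n - twinWeightMult x q n * (μ n : ℝ)) / 2 =
      ∑ n ∈ (twinSieveSet x).filter (fun n => q ∣ n ∧ IsRough ⌈w⌉₊ n), (1 - (μ n : ℝ)) / 2 := by
  classical
  have hS : (twinSieveSet x).filter (fun n => q ∣ n) ⊆ Finset.Ioc 0 (x + 2) :=
    (Finset.filter_subset _ _).trans (twinSieveSet_subset_Ioc x)
  have h := twistedSifted_indicator_eq_sum ((twinSieveSet x).filter (fun n => q ∣ n)) hS w
    (fun n => (μ n : ℝ))
  simp only [← twinWeightMult_eq_indicator] at h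
  rw [h, Finset.filter_filter]

/-- The twisted congruence sums of `𝒜_q` against `e = 1_{𝒜_q} μ`: for `(q, d) = 1`,
`E_d(x + 2) = ∑_{n ∈ 𝒜(x), qd ∣ n} μ(n)`. -/
theorem twistedCongrSum_twinSeqMult_moebius_eq {x q d : ℕ} (hqd : q.Coprime d) :
    ∑ n ∈ (Finset.Ioc 0 ⌊((x + 2 : ℕ) : ℝ)⌋₊).filter (d ∣ ·), twinWeightMult x q n * (μ n : ℝ) =
      ∑ n ∈ (twinSieveSet x).filter (fun n => q * d ∣ n), (μ n : ℝ) := by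
  classical
  have hS : (twinSieveSet x).filter (fun n => q ∣ n) ⊆ Finset.Ioc 0 (x + 2) :=
    (Finset.filter_subset _ _).trans (twinSieveSet_subset_Ioc x)
  have h := twistedCongrSum_indicator_eq_sum ((twinSieveSet x).filter (fun n => q ∣ n)) hS d
    (fun n => (μ n : ℝ))
  simp only [← twinWeightMult_eq_indicator] at h
  rw [h, Finset.filter_filter]
  congr 1
  ext n
  simp only [Finset.mem_filter]
  constructor
  · rintro ⟨hn, hq, hd⟩; exact ⟨hn, hqd.mul_dvd_of_dvd_of_dvd hq hd⟩
  · rintro ⟨hn, hqd'⟩; exact ⟨hn, (dvd_mul_right q d).trans hqd', (dvd_mul_left d q).trans hqd'⟩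

/-- `0 ≤ b(n) = ½(a(n) − a(n)μ(n))` for the weights of `𝒜_q`. -/
theorem twinWeightMult_twisted_nonneg (x q n : ℕ) :
    0 ≤ (twinWeightMult x q n - twinWeightMult x q n * (μ n : ℝ)) / 2 := by
  have := mul_le_self_of_abs_le_one (twinWeightMult_nonneg x q n) (Literature.NumberTheory.LFunctions.abs_moebius_real_le_one n)
  linarith

end Summit.Parity.GeneralizedHardyLittlewood.Theorems
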